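import Literature.NumberTheory.Sieve.BombieriFriedlanderIwaniecDispersion
import HarnessLib

/-!
# Bombieri–Friedlander–Iwaniec 1986: Theorem 9 (primes to moduli `qr`, `QR < x ℒ^{−B}`) and the
# bilinear Theorems 6 and 7* it rests on

Trunk `AntSieve`, third layer of the vendoring of E. Bombieri, J. B. Friedlander, H. Iwaniec,
*Primes in arithmetic progressions to large moduli*, Acta Math. 156 (1986), 203–251, after
`Literature.NumberTheory.Sieve.BombieriFriedlanderIwaniec` (Theorem 10) and
`Literature.NumberTheory.Sieve.BombieriFriedlanderIwaniecDispersion` (the dispersion sum `𝒟` of §3 and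
Theorems 1, 2, 5, 5*).  Requested by the crux `TypeI2Liouville` of
`Summits/Parity/GeneralizedHardyLittlewood/Theses/ShiftedMultiplicationTable` (the `Λ`-model of the
Liouville statement filed there): BFI's **Theorem 9** — the mean value theorem for primes in
progressions to moduli `qr`, `r ≤ R < x^{1/10−ε}`, `QR < x ℒ^{−B}`, with the absolute values outside
the `q`-sum only — together with the two bilinear theorems its proof (§16) appeals to, **Theorem 6**
(§13, the dispersion sum `𝒟` with the special weights (A₇) `γ_q = 1`) and **Theorem 7*** (§14, three
smooth variables).  All three are deep theorems (Linnik's dispersion method and the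
Deshouillers–Iwaniec bounds for sums of Kloosterman sums, Lemma 1); they are vendored as named facts
(D-0014) with the quantifier structure that BFI's conventions leave implicit made explicit, exactly as
in the two companion files.

## Contents

* `Literature.NumberTheory.Sieve.BFI.a7Weight Q₁` — the weights (A₇) of §13 (p. 241): `γ_q = 1` for
  `q ≤ Q₁`, `0` beyond (on the dyadic range `q ∼ Q` of `𝒟` this is "`γ_q = 1` for `Q < q ≤ Q₁`").
* `Literature.NumberTheory.Sieve.BFI.roughCongrCount`, `…roughCoprimeCount`, `…deltaStar` — the sums
  `Δ*(M, N, L, Q, R)` of §14 (p. 244 and Theorem 7*): for `r ≤ R`, `(r, a) = 1`, `l ≤ L`, `(l, r) = 1`,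
  the absolute value of `∑_{q ≤ Q, (q, al) = 1} ( #{m ≤ M, n ≤ N : lmn ≡ a (qr)} − φ(qr)⁻¹ #{m ≤ M,
  n ≤ N : (mn, qr) = 1} )`, the variables `l, m, n` being restricted to integers free of prime factors
  `p < z` (`roughIndicator z`, the (A₆*) coefficients of the companion file; `z ≤ 2` is no restriction,
  i.e. `Δ* = Δ`).
* Named facts `Literature.NumberTheory.Sieve.BombieriFriedlanderIwaniecTheorem6` (conclusion (3.2) for
  `𝒟` with the weights (A₇)), `…Theorem7Star` (`Δ* ≪ x ℒ^{−A}` under (14.5), (14.6)) and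
  `…Theorem9` (the `ψ`-form, as printed).
* PROVED: `BombieriFriedlanderIwaniecTheorem9.bound_nonneg` (cosmetic normalisation `C ≥ 0`,
  `B ≥ 0`, `x₀ ≥ 2`) and `BombieriFriedlanderIwaniecTheorem9.level_of_R_eq_one` (the case `R = 1`:
  `|∑_{q ≤ Q, (q,a)=1} (ψ(x; q, a) − x/φ(q))| ≤ C x ℒ^{−A}` for `Q < x ℒ^{−B}` — p. 250: "Corollary 1
  is an immediate consequence of Theorem 9 with `R = 1`", the Titchmarsh divisor problem being that
  consequence; only the specialisation is proved here); `BFI.abs_a7Weight_le`, `BFI.deltaStar_nonneg`.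

## Faithfulness (source read: Acta Math. 156, §1 pp. 206–209, §3 p. 214, §6 p. 220, §13 pp. 241–244,
§14 pp. 244–246, §16 p. 250; store key `paper:galaxy-pdf-3167048108437833940`, chunks 3–5, 9, 12,
31–32, 38–39, 43–44, 56)

* **Theorem 9** (§1, p. 209) is quoted in the docstring and rendered like Theorem 10 of the companion
  file: "`≪` depending on `ε, a, A`" becomes `∃ C x₀, ∀ x ≥ x₀`, "there exists `B = B(A)`" becomes
  `∃ B` after `a, ε, A` (the print lets `B` depend on `A`; letting it depend on `a, ε` too is weaker),
  `ψ(x; qr, a) = chebyshevPsiMod (q r) a x`, and the ranges `r ≤ R`, `q ≤ Q` are `Icc 1 ⌊R⌋₊`,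
  `Icc 1 ⌊Q⌋₊` (empty for `R < 1`, `Q < 1`).  BFI's `ε`-convention (Notations, p. 204: a statement
  with `ε` holds for all sufficiently small `ε > 0`) agrees with `∀ ε > 0` here since a larger `ε` only
  shrinks the range `R < x^{1/10−ε}`.
* **Theorem 6** (§13, p. 244: "Let (A₁)–(A₄) and (A₇) hold. Let `a ≠ 0` and `ε > 0`. We then have (3.2)
  provided `x^ε R < N < x^{−ε} (x/R)^{1/3}`"), where (3.2) (p. 214) is
  `𝒟(M, N, Q, R) ≪_A ‖α‖ ‖β‖ x^{1/2} ℒ^{−A}` "with any `A > 0`", and (A₇) (p. 241) is "`γ_q = 1` for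
  `Q < q ≤ Q₁` with `Q < Q₁ ≤ 2Q`, `QR < x ℒ^{−B}`" — `B` being, by the Notations (p. 204), "some
  sufficiently large, positive constant, not necessarily the same in each occurrence".  Rendered with
  the conventions of `BombieriFriedlanderIwaniecTheorem1` for (A₁)–(A₄) (`M N = x`, `x^ε ≤ N ≤ x^{1−ε}`;
  `SiegelWalfiszHyp N B Csw β`; `|δ_r| ≤ τ(r)^B`, `Q, R ≥ 1/2`; `IsSifted (dyadic N) (ℒ^{B₀}) β` with
  `B₀` existential, (6.5)), the level exponent of (A₇) existential (`∃ B₇`, chosen after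
  `a, ε, A, B, Csw`), `γ = a7Weight Q₁`, `α` and `δ` otherwise arbitrary real sequences, and the
  conclusion `|𝒟| ≤ C ‖α‖ ‖β‖ x^{1/2} ℒ^{−A}` with `‖α‖ = (∑_{m∼M} α_m²)^{1/2}`, `‖β‖ = (∑_{n∼N} β_n²)^{1/2}`.
  (13.1) `Q² R ≤ x` is a without-loss-of-generality reduction inside the proof (p. 241), not a
  hypothesis, and is not imposed.
* **Theorem 7*** (§14, p. 246: "THEOREM 7. If (14.5) and (14.6) hold, then we have (14.1). As in
  Section 12, using Lemma 4 we can extend the result to sums `Δ*(M, N, L, Q, R)` say, where the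
  variables `l, m, n` are free of prime factors `p < z (≤ z₀)`. This gives THEOREM 7*. If (14.5) and
  (14.6) hold then `Δ*(M, N, L, Q, R) ≪ x (log x)^{−A}`"), with (14.5) `LR < x^{1/2−ε}`, (14.6)
  `L^{1/2} R < M x^{−ε}`, `z₀ = exp(log x / log log x)` (Theorem 5*, p. 239) and the standing data of
  §14 (p. 244): `M, N, L, Q, R ≥ 1`, `LMN = x`.  Two points are NOT literal and are flagged: (i) the
  side conditions of the sum `Δ` on p. 244 are garbled in the held text layer; we read them off the
  smoothed sum `Δ₀` displayed on the same page (`r ∼ R, (r, a) = 1`; `l ∼ L, (l, r) = 1`;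
  `(q, al) = 1`), which is also the only reading under which each term is a genuine discrepancy
  (for `(l, qr) > 1` the congruence `lmn ≡ a (qr)` is insoluble while the subtracted mean is not
  zero); (ii) §§13–14 are the "special cases III, IV" serving Theorem 9, whose moduli obey the level
  condition `QR < x ℒ^{−B}` of (A₇) — §14 prints its constraints only as "(14.1) … subject to certain
  constraints on `M, N, L, Q, R`", and §16 applies Theorem 7* exactly in the regime `QR < x ℒ^{−B}`,
  `B = B(A)` — so the level condition is made an explicit hypothesis (`∃ B`), which can only weaken the
  vendored statement relative to a reading of the print that does not need it.  The unstarred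
  Theorem 7 (conclusion (14.1): `Δ ≪ x^{1−ε}`) is not vendored separately: for `z ≤ 2` the sum `Δ*` is
  `Δ`, and the `ℒ^{−A}` saving is what §16 consumes.
* Not vendored: Theorem 8 (§15) and the deduction §16 itself (Heath-Brown's identity, Lemma 4, the
  combinatorics (15.6), (16.1)–(16.2)); Corollary 1 (Titchmarsh divisor problem), which needs the
  divisor-sum main-term computation besides Theorem 9 with `R = 1`.
* `lean search` (`Theorem9`, `Theorem6`, `Theorem7`, `Titchmarsh`, `deltaStar`, `a7`): none of these is in
  the tree; `dispD`, `SiegelWalfiszHyp`, `IsSifted`, `roughIndicator`, `chebyshevPsiMod` are reused.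

## References

* E. Bombieri, J. B. Friedlander, H. Iwaniec, *Primes in arithmetic progressions to large moduli*,
  Acta Math. 156 (1986), 203–251: §1 Theorem 9 (p. 209); §3 (3.1)–(3.2) (p. 214); §13 (A₇) (p. 241),
  Theorem 6 (p. 244); §14 (pp. 244–246), Theorems 7, 7*; §16 (p. 250). [BombieriFriedlanderIwaniecActa1986]
-/

open Finset Real
open scoped ArithmeticFunction.sigma

namespace Literature.NumberTheory.Sieve

namespace BFI

/-! ### The weights (A₇) and the sums `Δ*` of §14 -/

/-- The special coefficients **(A₇)** of BFI §13 (p. 241: "`γ_q = 1` for `Q < q ≤ Q₁` with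
`Q < Q₁ ≤ 2Q`"): the indicator of `q ≤ Q₁`, to be used as the weight `γ` of the dispersion sum
`dispD … Q …`, whose `q` ranges over `q ∼ Q`, i.e. `Q < q ≤ 2Q`.
[cite: BombieriFriedlanderIwaniecActa1986, §13 (A₇) p. 241] -/
noncomputable def a7Weight (Q₁ : ℝ) (q : ℕ) : ℝ :=
  if (q : ℝ) ≤ Q₁ then 1 else 0

/-- `a7Weight Q₁ q ∈ {0, 1}`, in particular `|γ_q| ≤ 1 ≤ τ(q)^B`. [folklore] -/
theorem abs_a7Weight_le (Q₁ : ℝ) (q : ℕ) : |a7Weight Q₁ q| ≤ 1 := by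
  unfold a7Weight; split_ifs <;> simp

/-- `a7Weight Q₁ q = 1` for `q ≤ Q₁`. [folklore] -/
theorem a7Weight_of_le {Q₁ : ℝ} {q : ℕ} (h : (q : ℝ) ≤ Q₁) : a7Weight Q₁ q = 1 := by
  unfold a7Weight; rw [if_pos h]

/-- `a7Weight Q₁ q = 0` for `q > Q₁`. [folklore] -/
theorem a7Weight_of_lt {Q₁ : ℝ} {q : ℕ} (h : Q₁ < (q : ℝ)) : a7Weight Q₁ q = 0 := by
  unfold a7Weight; rw [if_neg (not_le.mpr h)]

/-- The congruence count of §14 (p. 244) with `z`-rough variables: for fixed `l` and modulus `d`,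
`#{m ≤ M, n ≤ N : lmn ≡ a (mod d), m, n free of prime factors < z}` (weights `roughIndicator z`,
which are `1` identically for `z ≤ 2`). [cite: BombieriFriedlanderIwaniecActa1986, §14 p. 244] -/
noncomputable def roughCongrCount (a : ℤ) (z M N : ℝ) (l d : ℕ) : ℝ :=
  ∑ m ∈ Icc 1 ⌊M⌋₊, ∑ n ∈ Icc 1 ⌊N⌋₊,
    if ((l * m * n : ℕ) : ZMod d) = (a : ZMod d) then roughIndicator z m * roughIndicator z n else 0

/-- The coprimality count of §14 (p. 244) with `z`-rough variables: for the modulus `d`,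
`#{m ≤ M, n ≤ N : (mn, d) = 1, m, n free of prime factors < z}`.
[cite: BombieriFriedlanderIwaniecActa1986, §14 p. 244] -/
noncomputable def roughCoprimeCount (z M N : ℝ) (d : ℕ) : ℝ :=
  ∑ m ∈ Icc 1 ⌊M⌋₊, ∑ n ∈ Icc 1 ⌊N⌋₊,
    if (m * n).Coprime d then roughIndicator z m * roughIndicator z n else 0

/-- **The sums `Δ*(M, N, L, Q, R)` of BFI §14** (p. 244 with Theorem 7*, p. 246):
`Δ* = ∑_{r ≤ R, (r, a) = 1} ∑_{l ≤ L, (l, r) = 1} | ∑_{q ≤ Q, (q, al) = 1} ( #{m ≤ M, n ≤ N :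
lmn ≡ a (qr)} − φ(qr)⁻¹ #{m ≤ M, n ≤ N : (mn, qr) = 1} ) |`, "where the variables `l, m, n` are free
of prime factors `p < z`" (for `z ≤ 2` this is the sum `Δ(M, N, L, Q, R)` of (14.1)).  The side
conditions `(r, a) = 1`, `(l, r) = 1`, `(q, al) = 1` are those of the smoothed sum `Δ₀` displayed on
p. 244 (see the module docstring, Faithfulness (i)).
[cite: BombieriFriedlanderIwaniecActa1986, §14 p. 244 and Theorem 7* p. 246] -/
noncomputable def deltaStar (a : ℤ) (z M N L Q R : ℝ) : ℝ :=
  ∑ r ∈ (Icc 1 ⌊R⌋₊).filter (fun r : ℕ => IsCoprime (r : ℤ) a),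
    ∑ l ∈ (Icc 1 ⌊L⌋₊).filter (fun l : ℕ => l.Coprime r),
      roughIndicator z l *
        |∑ q ∈ (Icc 1 ⌊Q⌋₊).filter (fun q : ℕ => IsCoprime (q : ℤ) (a * l)),
          (roughCongrCount a z M N l (q * r) -
            roughCoprimeCount z M N (q * r) / (Nat.totient (q * r) : ℝ))|

/-- `roughIndicator z m ≥ 0`. [folklore] -/
theorem roughIndicator_nonneg (z : ℝ) (m : ℕ) : 0 ≤ roughIndicator z m := by
  unfold roughIndicator; split_ifs <;> norm_num

/-- `Δ* ≥ 0` (a sum of nonnegative weights times absolute values). [folklore] -/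
theorem deltaStar_nonneg (a : ℤ) (z M N L Q R : ℝ) : 0 ≤ deltaStar a z M N L Q R :=
  sum_nonneg fun _ _ => sum_nonneg fun _ _ => mul_nonneg (roughIndicator_nonneg _ _) (abs_nonneg _)

end BFI

open BFI

/-! ### Theorem 6 (the dispersion sum with the weights (A₇), conclusion (3.2)) -/

/-- **Bombieri–Friedlander–Iwaniec 1986, Theorem 6** (§13, p. 244: "Let (A₁)–(A₄) and (A₇) hold. Let
`a ≠ 0` and `ε > 0`. We then have (3.2) provided `x^ε R < N < x^{−ε} (x/R)^{1/3}`"), where (3.2)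
(p. 214) is `𝒟(M, N, Q, R) ≪_A ‖α‖ ‖β‖ x^{1/2} ℒ^{−A}` for any `A > 0`, `𝒟` being the dispersion sum
(3.1) (`Literature.NumberTheory.Sieve.BFI.dispD`), and (A₇) (p. 241) is "`γ_q = 1` for `Q < q ≤ Q₁` with
`Q < Q₁ ≤ 2Q`, `QR < x ℒ^{−B}`" (`B` "some sufficiently large, positive constant", Notations p. 204).
Rendered with all dependencies explicit, as `BombieriFriedlanderIwaniecTheorem1`: for `a ≠ 0`, `ε > 0`,
`A > 0`, a divisor exponent `B ≥ 0` and Siegel–Walfisz constants `Csw`, there are `B₀` (sifting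
exponent, (6.5)), `B₇` (the level exponent of (A₇)), `C`, `x₀` such that for `x ≥ x₀`, all `M N = x`
with `x^ε ≤ N ≤ x^{1−ε}` (A₁), `Q, R ≥ 1/2`, `Q < Q₁ ≤ 2Q`, `QR < x ℒ^{−B₇}` (A₇), in the range
`x^ε R < N < x^{−ε} (x/R)^{1/3}`, every real `β` with (A₂) (`SiegelWalfiszHyp N B Csw β`) and (A₄)
(`β_n = 0` if `n ∼ N` has a prime factor `≤ ℒ^{B₀}`), every real `α` (`m ∼ M`) and every real `δ` with
`|δ_r| ≤ τ(r)^B` (A₃):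
`|𝒟(M, N, Q, R; α, β, γ = 1_{q ≤ Q₁}, δ)| ≤ C ‖α‖ ‖β‖ x^{1/2} ℒ^{−A}`,
`‖α‖ = (∑_{m∼M} α_m²)^{1/2}`, `‖β‖ = (∑_{n∼N} β_n²)^{1/2}`.  A deep THEOREM (dispersion method and the
Deshouillers–Iwaniec bounds, Lemma 1, applied directly in §13); not in Mathlib.
[cite: BombieriFriedlanderIwaniecActa1986, §13 Theorem 6 p. 244, (A₇) p. 241, (3.2) p. 214] -/
def BombieriFriedlanderIwaniecTheorem6 : Prop :=
  ∀ a : ℤ, a ≠ 0 → ∀ ε : ℝ, 0 < ε → ∀ A : ℝ, 0 < A → ∀ B : ℝ, 0 ≤ B → ∀ Csw : ℝ → ℝ,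
    ∃ B₀ B₇ C x₀ : ℝ, ∀ x : ℝ, x₀ ≤ x → ∀ M N Q R Q₁ : ℝ,
      M * N = x → x ^ ε ≤ N → N ≤ x ^ (1 - ε) →
      1 / 2 ≤ Q → 1 / 2 ≤ R → Q < Q₁ → Q₁ ≤ 2 * Q → Q * R < x / Real.log x ^ B₇ →
      x ^ ε * R < N → N < x ^ (-ε) * (x / R) ^ (1 / 3 : ℝ) →
      ∀ β : ℕ → ℝ, SiegelWalfiszHyp N B Csw β → IsSifted (dyadic N) (Real.log x ^ B₀) β →
      ∀ α δ : ℕ → ℝ, (∀ r, |δ r| ≤ (σ 0 r : ℝ) ^ B) →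
        |dispD a M N Q R α β (a7Weight Q₁) δ| ≤
          C * Real.sqrt (l2Sq M α) * Real.sqrt (l2Sq N β) * x ^ (1 / 2 : ℝ) / Real.log x ^ A

/-! ### Theorem 7* (three smooth, `z`-rough variables) -/

/-- **Bombieri–Friedlander–Iwaniec 1986, Theorem 7*** (§14, p. 246: "THEOREM 7. If (14.5) and (14.6)
hold, then we have (14.1). As in Section 12, using Lemma 4 we can extend the result to sums
`Δ*(M, N, L, Q, R)` say, where the variables `l, m, n` are free of prime factors `p < z (≤ z₀)`. This
gives THEOREM 7*. If (14.5) and (14.6) hold then `Δ*(M, N, L, Q, R) ≪ x (log x)^{−A}`"), where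
(14.5) is `LR < x^{1/2−ε}`, (14.6) is `L^{1/2} R < M x^{−ε}` (p. 246), `z₀ = exp(log x / log log x)`
(p. 239), and §14 (p. 244) fixes `M, N, L, Q, R ≥ 1`, `LMN = x` and the sums `Δ`
(`Literature.NumberTheory.Sieve.BFI.deltaStar`, with the side conditions read off `Δ₀`, see the module
docstring).  Rendered: for `a ≠ 0`, `ε > 0`, `A > 0` there are `B`, `C`, `x₀` such that for `x ≥ x₀`,
all `M, N, L, Q, R ≥ 1` with `LMN = x`, **`QR < x ℒ^{−B}`** (the level condition of (A₇)/§16 under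
which §§13–14 operate and §16 applies the theorem — made explicit here, which can only weaken the
statement; §14 prints its standing constraints only as "subject to certain constraints on
`M, N, L, Q, R`"), (14.5), (14.6) and every `z ≤ exp(log x / log log x)`:
`Δ*(M, N, L, Q, R) ≤ C x ℒ^{−A}`.  BFI's floating `ε` enters only the hypotheses (14.5)–(14.6), so
`∀ ε > 0` is the faithful reading.  A deep THEOREM (dispersion, Lemmas 1, 2 and the fundamental lemma,
Lemma 4); not in Mathlib. [cite: BombieriFriedlanderIwaniecActa1986, §14 Theorems 7 and 7* p. 246, (14.5)–(14.6)] -/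
def BombieriFriedlanderIwaniecTheorem7Star : Prop :=
  ∀ a : ℤ, a ≠ 0 → ∀ ε : ℝ, 0 < ε → ∀ A : ℝ, 0 < A →
    ∃ B C x₀ : ℝ, ∀ x : ℝ, x₀ ≤ x → ∀ M N L Q R : ℝ,
      1 ≤ M → 1 ≤ N → 1 ≤ L → 1 ≤ Q → 1 ≤ R → L * M * N = x →
      Q * R < x / Real.log x ^ B →
      L * R < x ^ (1 / 2 - ε) →
      L ^ (1 / 2 : ℝ) * R < M * x ^ (-ε) →
      ∀ z : ℝ, z ≤ Real.exp (Real.log x / Real.log (Real.log x)) →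
        deltaStar a z M N L Q R ≤ C * x / Real.log x ^ A

/-! ### Theorem 9 (as printed, the `ψ`-form) -/

/-- **Bombieri–Friedlander–Iwaniec 1986, Theorem 9** (as printed, Acta Math. 156 (1986), §1, p. 209:
"Let `a ≠ 0`, `ε > 0` and `R < x^{1/10−ε}`. For any `A > 0` there exists `B = B(A)` such that provided
`QR < x ℒ^{−B}` we have
`∑_{r ≤ R, (r,a)=1} | ∑_{q ≤ Q, (q,a)=1} ( ψ(x; qr, a) − x/φ(qr) ) | ≪ x ℒ^{−A}`;
the constant implied in `≪` depends at most on `ε`, `a` and `A`" (`ℒ = log x`)).  Rendered as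
`BombieriFriedlanderIwaniecTheorem10`: for `a ≠ 0`, `ε > 0`, `A > 0` there are `B, C, x₀` such that for
all `x ≥ x₀` and all real `Q, R` with `R < x^{1/10−ε}` and `QR < x/(log x)^B`,
`∑_{1 ≤ r ≤ R, (r,a)=1} |∑_{1 ≤ q ≤ Q, (q,a)=1} (ψ(x; qr, a) − x/φ(qr))| ≤ C x/(log x)^A`, where
`ψ(x; d, a) = chebyshevPsiMod d a x`.  Proved in §16 of the source from Theorems 6 and 7* through the
machinery of §15 (Heath-Brown's identity, the fundamental lemma); with `R = 1` it gives Corollary 1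
(the Titchmarsh divisor problem).  A deep THEOREM; not in Mathlib.
[cite: BombieriFriedlanderIwaniecActa1986, §1 Theorem 9 p. 209; §16 p. 250] -/
def BombieriFriedlanderIwaniecTheorem9 : Prop :=
  ∀ a : ℤ, a ≠ 0 → ∀ ε : ℝ, 0 < ε → ∀ A : ℝ, 0 < A →
    ∃ B C x₀ : ℝ, ∀ x : ℝ, x₀ ≤ x → ∀ Q R : ℝ,
      R < x ^ (1 / 10 - ε) → Q * R < x / Real.log x ^ B →
        ∑ r ∈ (Icc 1 ⌊R⌋₊).filter (fun r : ℕ => IsCoprime (r : ℤ) a),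
          |∑ q ∈ (Icc 1 ⌊Q⌋₊).filter (fun q : ℕ => IsCoprime (q : ℤ) a),
            (LevelOfDistribution.chebyshevPsiMod (q * r) (a : ZMod (q * r)) x -
              x / (Nat.totient (q * r) : ℝ))| ≤
          C * x / Real.log x ^ A

/-- Unfolding `BombieriFriedlanderIwaniecTheorem9` at given `a, ε, A`, with the exponents and the
constant normalised to be nonnegative and the threshold to be `≥ 2` (cosmetic: a larger `B` shrinks
the range `QR < x ℒ^{−B}` once `log x ≥ 1`). [folklore] -/
theorem BombieriFriedlanderIwaniecTheorem9.bound_nonneg (h : BombieriFriedlanderIwaniecTheorem9)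
    {a : ℤ} (ha : a ≠ 0) {ε : ℝ} (hε : 0 < ε) {A : ℝ} (hA : 0 < A) :
    ∃ B C x₀ : ℝ, 0 ≤ B ∧ 0 ≤ C ∧ 2 ≤ x₀ ∧ ∀ x : ℝ, x₀ ≤ x → ∀ Q R : ℝ,
      R < x ^ (1 / 10 - ε) → Q * R < x / Real.log x ^ B →
        ∑ r ∈ (Icc 1 ⌊R⌋₊).filter (fun r : ℕ => IsCoprime (r : ℤ) a),
          |∑ q ∈ (Icc 1 ⌊Q⌋₊).filter (fun q : ℕ => IsCoprime (q : ℤ) a),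
            (LevelOfDistribution.chebyshevPsiMod (q * r) (a : ZMod (q * r)) x -
              x / (Nat.totient (q * r) : ℝ))| ≤
          C * x / Real.log x ^ A := by
  obtain ⟨B, C, x₀, hC⟩ := h a ha ε hε A hA
  refine ⟨max B 0, max C 0, max x₀ (Real.exp 1), le_max_right _ _, le_max_right _ _,
    (le_max_right _ _).trans' (by have := Real.add_one_le_exp (1 : ℝ); linarith), fun x hx Q R hR hQR => ?_⟩
  have hx₀ : x₀ ≤ x := (le_max_left _ _).trans hx
  have hxe : Real.exp 1 ≤ x := (le_max_right _ _).trans hx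
  have hxpos : 0 < x := (Real.exp_pos 1).trans_le hxe
  have hlog : 1 ≤ Real.log x := by
    rw [← Real.log_exp 1]; exact Real.log_le_log (Real.exp_pos 1) hxe
  -- the level `x / ℒ^{max B 0}` is at most `x / ℒ^B`
  have hQR' : Q * R < x / Real.log x ^ B := by
    refine hQR.trans_le ?_
    refine div_le_div_of_nonneg_left hxpos.le (Real.rpow_pos_of_pos (by linarith) _) ?_
    exact Real.rpow_le_rpow_of_exponent_le hlog (le_max_left _ _)
  refine (hC x hx₀ Q R hR hQR').trans ?_
  have hlogpos : 0 < Real.log x := by linarith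
  gcongr
  exact le_max_left _ _

/-- `ψ(x; d, a)` depends on the modulus only through its value (transport of the residue class
`a mod d` along `d = d'`). [folklore] -/
theorem chebyshevPsiMod_modulus_congr {d d' : ℕ} (h : d = d') (a : ℤ) (x : ℝ) :
    LevelOfDistribution.chebyshevPsiMod d (a : ZMod d) x =
      LevelOfDistribution.chebyshevPsiMod d' (a : ZMod d') x := by
  subst h; rfl

/-- **The case `R = 1` of Theorem 9** (p. 250: "Corollary 1 is an immediate consequence of Theorem 9 with
`R = 1`"): for `a ≠ 0` and `A > 0` there are `B, C, x₀` such that for `x ≥ x₀` and every real `Q` with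
`Q < x/(log x)^B`, `|∑_{1 ≤ q ≤ Q, (q,a)=1} (ψ(x; q, a) − x/φ(q))| ≤ C x/(log x)^A` — primes in
progressions to moduli almost up to `x`, with the absolute value OUTSIDE the sum over the moduli.
PROVED from the named fact (`ε = 1/20`, `R = 1 < x^{1/20}`; the `r`-sum is the single term `r = 1`).
[cite: BombieriFriedlanderIwaniecActa1986, §1 Theorem 9 p. 209 and §16 p. 250] -/
theorem BombieriFriedlanderIwaniecTheorem9.level_of_R_eq_one (h : BombieriFriedlanderIwaniecTheorem9)
    {a : ℤ} (ha : a ≠ 0) {A : ℝ} (hA : 0 < A) :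
    ∃ B C x₀ : ℝ, ∀ x : ℝ, x₀ ≤ x → ∀ Q : ℝ, Q < x / Real.log x ^ B →
      |∑ q ∈ (Icc 1 ⌊Q⌋₊).filter (fun q : ℕ => IsCoprime (q : ℤ) a),
          (LevelOfDistribution.chebyshevPsiMod q (a : ZMod q) x - x / (Nat.totient q : ℝ))| ≤
        C * x / Real.log x ^ A := by
  obtain ⟨B, C, x₀, -, -, hx₀2, hC⟩ := h.bound_nonneg ha (by norm_num : (0 : ℝ) < 1 / 20) hA
  refine ⟨B, C, x₀, fun x hx Q hQ => ?_⟩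
  have hx2 : 2 ≤ x := hx₀2.trans hx
  have hR : (1 : ℝ) < x ^ (1 / 10 - 1 / 20 : ℝ) := by
    rw [show (1 / 10 - 1 / 20 : ℝ) = 1 / 20 by norm_num]
    exact Real.one_lt_rpow (by linarith) (by norm_num)
  have key := hC x hx Q 1 hR (by rwa [mul_one])
  -- the `r`-sum at `R = 1` is the single term `r = 1`
  have hset : (Icc 1 ⌊(1 : ℝ)⌋₊).filter (fun r : ℕ => IsCoprime (r : ℤ) a) = {1} := by
    rw [Nat.floor_one, Finset.Icc_self]
    ext r
    simp only [Finset.mem_filter, Finset.mem_singleton, and_iff_left_iff_imp]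
    rintro rfl
    simpa using isCoprime_one_left (x := a)
  rw [hset, Finset.sum_singleton] at key
  have hsum : (∑ q ∈ (Icc 1 ⌊Q⌋₊).filter (fun q : ℕ => IsCoprime (q : ℤ) a),
      (LevelOfDistribution.chebyshevPsiMod (q * 1) (a : ZMod (q * 1)) x -
        x / (Nat.totient (q * 1) : ℝ))) =
      ∑ q ∈ (Icc 1 ⌊Q⌋₊).filter (fun q : ℕ => IsCoprime (q : ℤ) a),
        (LevelOfDistribution.chebyshevPsiMod q (a : ZMod q) x - x / (Nat.totient q : ℝ)) :=
    Finset.sum_congr rfl fun q _ => by rw [chebyshevPsiMod_modulus_congr (mul_one q), mul_one]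
  rwa [hsum] at key

end Literature.NumberTheory.Sieve
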